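import Mathlib

/-!
# Crux `ExactCertificate` (stmt-AtomisticToContinuum-11959), line `closure-makes-nogap-exact`,
# skeleton IX (`FarSlackActive`): stub `stub_planeIntegralMaxPow` (F2)

Support file for the crux `ThreeConeCertificate.ExactCertificate`, skeleton IX
(`Cruxes.ExactCertificate.FarEqual`), which computes the Fourier slice of the capped power
kernel `v ↦ max(‖v‖², ρ²)^{-m}` on `ℝ³` by slicing `ℝ³ = ℝ × ℝ²`.  This file supplies the explicit
"plank profile": for `m ≥ 2` and `ρ > 0`, the integral over the transverse plane `ℝ²` of
`y ↦ max(x² + ‖y‖², ρ²)^{-m}` in closed form,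

  `∫_{ℝ²} max(x² + ‖y‖², ρ²)^{-m} dy = π/(m-1) · max(x², ρ²)^{-(m-1)} + π · max(ρ² - x², 0) · ρ^{-2m}`,

together with the integrability of the integrand.

Proof: polar coordinates in `ℝ²` followed by `t = r²` give `∫_{ℝ²} G(‖y‖²) dy = π ∫₀^∞ G(t) dt`
(`integral_fun_norm_addHaar`, `EuclideanSpace.volume_ball_fin_two`, `integral_comp_rpow_Ioi_of_pos`;
both sides with Bochner junk value `0`).  With `H(u) := max(u, ρ²)^{-m}` the profile is
`π ∫₀^∞ H(x² + t) dt = π ∫_{x²}^∞ H(u) du` (translation invariance), and splitting `(x², ∞)` at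
`M := max(x², ρ²)`: on `(x², M]` the integrand is the constant `ρ^{-2m}` (length `max(ρ² - x², 0)`),
on `(M, ∞)` it is `u^{-m}` with `∫_M^∞ u^{-m} du = M^{1-m}/(m-1)` (`integral_Ioi_rpow_of_lt`).
Integrability on `ℝ²` then follows because the Bochner integral is nonzero (`integral_undef`).
Pure Mathlib; private helper lemmas only, no named facts.  All `[folklore]`.
-/

noncomputable section

namespace Summit.AtomisticToContinuum.Crystallization.Theorems.ThreeConeCertificateExactCertificate.FarEqual

open MeasureTheory Set Metric

/-- Planar radial integration in the variable `t = r²`: `∫_{ℝ²} G(‖y‖²) dy = π ∫₀^∞ G(t) dt`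
(polar coordinates `dy = 2πr dr`, then `t = r²`; both sides with Bochner junk value `0`). [folklore] -/
private theorem integral_fun_norm_sq (G : ℝ → ℝ) :
    ∫ y : EuclideanSpace ℝ (Fin 2), G (‖y‖ ^ 2) = Real.pi * ∫ t in Ioi (0 : ℝ), G t := by
  -- adapted from Literature/Analysis/FluidPDE/BurgersVortexSteady.lean (`integral_comp_mul_norm_sq`)
  have h1 := MeasureTheory.integral_fun_norm_addHaar
    (volume : Measure (EuclideanSpace ℝ (Fin 2))) (fun r => G (r ^ 2))
  rw [h1, finrank_euclideanSpace_fin]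
  have hball : (volume : Measure (EuclideanSpace ℝ (Fin 2))).real (ball 0 1) = Real.pi := by
    rw [measureReal_def, EuclideanSpace.volume_ball_fin_two]
    simp [Real.pi_pos.le]
  rw [hball]
  have h2 := integral_comp_rpow_Ioi_of_pos (g := G) two_pos
  have h4 : ∫ r in Ioi (0 : ℝ), r ^ (2 - 1) • G (r ^ 2) =
      2⁻¹ * ∫ r in Ioi (0 : ℝ), ((2 : ℝ) * r ^ ((2 : ℝ) - 1)) • G (r ^ (2 : ℝ)) := by
    rw [← smul_eq_mul, ← integral_smul]
    refine setIntegral_congr_fun measurableSet_Ioi fun r _ => ?_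
    simp only [smul_eq_mul, show ((2 : ℝ) - 1) = 1 by norm_num, Real.rpow_one, Real.rpow_two]
    norm_num
    ring
  rw [h4, h2]
  simp only [nsmul_eq_mul, smul_eq_mul, Nat.cast_ofNat]
  ring

/-- Translation on the half-line: `∫₀^∞ H(c + t) dt = ∫_c^∞ H(u) du` (Lebesgue measure is
translation invariant; both sides with junk value `0`). [folklore] -/
private theorem integral_Ioi_comp_const_add (H : ℝ → ℝ) (c : ℝ) :
    ∫ t in Ioi (0 : ℝ), H (c + t) = ∫ u in Ioi c, H u := by
  have h := (measurePreserving_add_right volume c).setIntegral_preimage_emb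
    (measurableEmbedding_addRight c) H (Ioi c)
  rw [preimage_add_const_Ioi, sub_self] at h
  simpa only [add_comm] using h

/-- The half-line profile: for `m ≥ 2`, `ρ > 0`,
`∫₀^∞ max(x² + t, ρ²)^{-m} dt = max(x², ρ²)^{-(m-1)}/(m-1) + max(ρ² - x², 0) ρ^{-2m}`
(split `(x², ∞)` at `max(x², ρ²)`; constant integrand below, `u^{-m}` above). [folklore] -/
private theorem integral_Ioi_inv_max_pow {m : ℕ} {ρ : ℝ} (hm : 2 ≤ m) (hρ : 0 < ρ) (x : ℝ) :
    ∫ t in Ioi (0 : ℝ), ((max (x ^ 2 + t) (ρ ^ 2))⁻¹) ^ m =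
      1 / ((m : ℝ) - 1) * ((max (x ^ 2) (ρ ^ 2))⁻¹) ^ (m - 1) +
        max (ρ ^ 2 - x ^ 2) 0 * ((ρ ^ 2)⁻¹) ^ m := by
  set H : ℝ → ℝ := fun u => ((max u (ρ ^ 2))⁻¹) ^ m with hH
  set M : ℝ := max (x ^ 2) (ρ ^ 2) with hM
  have hρ2 : 0 < ρ ^ 2 := by positivity
  have hMpos : 0 < M := hρ2.trans_le (le_max_right _ _)
  have hm1 : (1 : ℕ) ≤ m := by omega
  have hmr : (-(m : ℝ)) < -1 := by
    have : (2 : ℝ) ≤ m := by exact_mod_cast hm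
    linarith
  -- translate to `(x², ∞)`
  have htr : ∫ t in Ioi (0 : ℝ), ((max (x ^ 2 + t) (ρ ^ 2))⁻¹) ^ m = ∫ u in Ioi (x ^ 2), H u :=
    integral_Ioi_comp_const_add H (x ^ 2)
  rw [htr]
  -- the integrand on the two pieces
  have hlow : ∀ u ∈ Ioc (x ^ 2) M, H u = ((ρ ^ 2)⁻¹) ^ m := by
    intro u hu
    have hu2 : u ≤ ρ ^ 2 := ((le_max_iff).1 hu.2).resolve_left (not_le.2 hu.1)
    simp only [hH, max_eq_right hu2]
  have hhigh : ∀ u ∈ Ioi M, H u = u ^ (-(m : ℝ)) := by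
    intro u hu
    have huρ : ρ ^ 2 ≤ u := ((le_max_right _ _).trans_lt hu).le
    have hu0 : 0 ≤ u := hρ2.le.trans huρ
    simp only [hH, max_eq_left huρ]
    rw [Real.rpow_neg hu0, Real.rpow_natCast, inv_pow]
  -- integrability on the two pieces
  have hint1 : IntegrableOn H (Ioc (x ^ 2) M) :=
    (integrableOn_const (C := ((ρ ^ 2)⁻¹) ^ m) (hs := measure_Ioc_lt_top.ne)).congr_fun
      (fun u hu => (hlow u hu).symm) measurableSet_Ioc
  have hint2 : IntegrableOn H (Ioi M) :=
    (integrableOn_Ioi_rpow_of_lt hmr hMpos).congr_fun (fun u hu => (hhigh u hu).symm)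
      measurableSet_Ioi
  rw [← Ioc_union_Ioi_eq_Ioi (le_max_left (x ^ 2) (ρ ^ 2) : x ^ 2 ≤ M),
    setIntegral_union Ioc_disjoint_Ioi_same measurableSet_Ioi hint1 hint2,
    setIntegral_congr_fun measurableSet_Ioc hlow, setIntegral_congr_fun measurableSet_Ioi hhigh,
    setIntegral_const, Real.volume_real_Ioc, integral_Ioi_rpow_of_lt hmr hMpos, smul_eq_mul]
  -- bookkeeping of the closed form
  have hpow : M ^ (-(m : ℝ) + 1) = (M⁻¹) ^ (m - 1) := by
    rw [show (-(m : ℝ) + 1) = -(((m - 1 : ℕ) : ℝ)) by push_cast [Nat.cast_sub hm1]; ring,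
      Real.rpow_neg hMpos.le, Real.rpow_natCast, inv_pow]
  rw [hpow]
  have hlen : max (M - x ^ 2) 0 = max (ρ ^ 2 - x ^ 2) 0 := by
    rcases le_total (x ^ 2) (ρ ^ 2) with h | h
    · rw [hM, max_eq_right h]
    · rw [hM, max_eq_left h, sub_self, max_eq_right (sub_nonpos.2 h), max_self]
  rw [hlen]
  have hneg : (-(m : ℝ) + 1) = -((m : ℝ) - 1) := by ring
  rw [hneg, div_neg, neg_div, neg_neg]
  ring

/-- **Plank profile of the capped power kernel** (stub F2 of skeleton IX): for `m ≥ 2`, `ρ > 0`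
and every `x : ℝ`, the function `y ↦ max(x² + ‖y‖², ρ²)^{-m}` is integrable on `ℝ²` and
`∫_{ℝ²} max(x² + ‖y‖², ρ²)^{-m} dy = π/(m-1) · max(x², ρ²)^{-(m-1)} + π · max(ρ² - x², 0) · ρ^{-2m}`
(polar coordinates and the half-line profile; integrability because the integral is nonzero).
[folklore] -/
theorem stub_planeIntegralMaxPow : ∀ (m : ℕ) (ρ x : ℝ), 2 ≤ m → 0 < ρ →
      MeasureTheory.Integrable (fun y : EuclideanSpace ℝ (Fin 2) => ((max (x ^ 2 + ‖y‖ ^ 2) (ρ ^ 2))⁻¹) ^ m) ∧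
        ∫ y : EuclideanSpace ℝ (Fin 2), ((max (x ^ 2 + ‖y‖ ^ 2) (ρ ^ 2))⁻¹) ^ m =
          Real.pi / ((m : ℝ) - 1) * ((max (x ^ 2) (ρ ^ 2))⁻¹) ^ (m - 1) +
            Real.pi * max (ρ ^ 2 - x ^ 2) 0 * ((ρ ^ 2)⁻¹) ^ m := by
  intro m ρ x hm hρ
  have hval : ∫ y : EuclideanSpace ℝ (Fin 2), ((max (x ^ 2 + ‖y‖ ^ 2) (ρ ^ 2))⁻¹) ^ m =
      Real.pi / ((m : ℝ) - 1) * ((max (x ^ 2) (ρ ^ 2))⁻¹) ^ (m - 1) +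
        Real.pi * max (ρ ^ 2 - x ^ 2) 0 * ((ρ ^ 2)⁻¹) ^ m := by
    have h2 : ∫ y : EuclideanSpace ℝ (Fin 2), ((max (x ^ 2 + ‖y‖ ^ 2) (ρ ^ 2))⁻¹) ^ m =
        Real.pi * ∫ t in Ioi (0 : ℝ), ((max (x ^ 2 + t) (ρ ^ 2))⁻¹) ^ m :=
      integral_fun_norm_sq fun t => ((max (x ^ 2 + t) (ρ ^ 2))⁻¹) ^ m
    rw [h2, integral_Ioi_inv_max_pow hm hρ x]
    ring
  refine ⟨?_, hval⟩
  -- integrability: the Bochner integral is nonzero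
  by_contra hni
  have hρ2 : 0 < ρ ^ 2 := by positivity
  have hMpos : 0 < max (x ^ 2) (ρ ^ 2) := hρ2.trans_le (le_max_right _ _)
  have hm1 : (0 : ℝ) < (m : ℝ) - 1 := by
    have : (2 : ℝ) ≤ m := by exact_mod_cast hm
    linarith
  have hpos : 0 < Real.pi / ((m : ℝ) - 1) * ((max (x ^ 2) (ρ ^ 2))⁻¹) ^ (m - 1) +
      Real.pi * max (ρ ^ 2 - x ^ 2) 0 * ((ρ ^ 2)⁻¹) ^ m := by
    have h1 : 0 < Real.pi / ((m : ℝ) - 1) * ((max (x ^ 2) (ρ ^ 2))⁻¹) ^ (m - 1) := by positivity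
    have h2 : 0 ≤ Real.pi * max (ρ ^ 2 - x ^ 2) 0 * ((ρ ^ 2)⁻¹) ^ m := by positivity
    linarith
  rw [integral_undef hni] at hval
  exact hpos.ne hval

end Summit.AtomisticToContinuum.Crystallization.Theorems.ThreeConeCertificateExactCertificate.FarEqual
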